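import Summits.QuantumFields.GaugeBoot.TiltedSiteRPGeometry
import HarnessLib

/-!
# Link (mid-plane) reflections on a periodic lattice: the reflection `x_k ↦ 1 - x_k` (gauge-boot, L3(υ) part 1)

HONEST FRAMING (cell `pub-gaugeboot`, page 1 of every file): the venture produces certified bounds
on lattice expectations at stated coupling, gauge group, dimension and torus size; NOT a mass gap,
NOT a continuum limit, NOT a string tension; NOT Yang–Mills-summit-bearing (barriers
`FixedCouplingUltralocality`, `PerturbativeInvisibility`).

Companion of `TiltedSiteRPGeometry.lean` (reflection `x_k ↦ -x_k` through SITES) for the THIRD kind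
of reflection available on the 45°-tilted periodic box of Fröhlich–Israel–Lieb–Simon
(`TiltedBox.lean`) along an axis `k ∉ {i, j}` of even period `2Q`: the Osterwalder–Seiler
reflection `x_k ↦ 1 - x_k` in the hyperplane `x_k = ½` lying MIDWAY between two lattice layers
(the second RP family of the lattice bootstrap, Kazakov–Zheng arXiv:2203.11360 §3.1; the tree's
`configLinkReflect` of `ClassB.lean` on `ℤ^d` and `GaugeConfig.timeReflect` of
`Literature.MathematicalPhysics.QuantumFieldTheory.ConstructiveQFTWave0` on the cubic torus).

No new frame is needed: a SITE FRAME `IsSiteFrame e k σ Q h` of `TiltedSiteRPGeometry.lean`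
(additive involution `σ` with `σ (e k) = -e k`, height `h : A →+ ZMod (2Q)`, both layers `h = 0`,
`h = Q` pointwise `σ`-fixed) also carries the mid-plane reflection

  `θ x = σ x + e k`  (`midReflect`),   `h (θ x) = 1 - h x`,

an involution WITHOUT fixed sites exchanging the closed half `Λ₊ = {1 ≤ h ≤ Q}` with
`Λ₋ = {Q + 1, …, 2Q - 1, 0}`; the layer axiom gives `θ x = x + e k` on the layers `h = 0`, `h = Q`,
i.e. the `k`-links based in these two layers CROSS the two reflection hyperplanes `h = ½`,
`h = Q + ½` and are mapped onto themselves, reversed. Contents of this file: `midReflect`,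
the induced maps `midLinkMap` (links; `k`-links reversed) and `configMidReflect` (configurations;
reversed links carry the inverse — the tree's orientation rule), their involutivity, the height
bookkeeping, the link classes (positive links = both endpoints in `Λ₊`; lower / upper crossing
links) and the two facts the Osterwalder–Seiler argument needs: the reflection carries positive
and crossing links to non-positive links (`not_isMidPosLink_midLinkMap`) and positive links to
non-crossing links (`not_isMidCrossLink_midLinkMap`). Plaquettes: `TiltedLinkRPPlaquettes.lean`;
holonomies and the action: `TiltedLinkRPHolonomy.lean`; the crossing identity:
`TiltedLinkRPCrossing.lean`; positivity: `TiltedLinkRPPositivity.lean`; the tilted box: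
`TiltedBoxLinkRP.lean`.

References: K. Osterwalder, E. Seiler, Ann. Phys. 110 (1978) 440, §2; E. Seiler, LNP 159 (1982);
J. Glimm, A. Jaffe, Quantum Physics (2nd ed.) Thm. 7.10.2; V. Kazakov, Z. Zheng,
arXiv:2203.11360 §3.1 (the three RP families of the bootstrap).
-/

namespace Summit.QuantumFields.GaugeBoot

namespace TiltedRP

variable {A : Type*} [AddCommGroup A] {d : ℕ}

/-! ## The mid-plane reflection of sites, links and configurations -/

/-- The mid-plane (link) reflection of sites attached to a site reflection `σ` in direction `k`:
`θ x = σ x + e k` (`x_k ↦ 1 - x_k`). -/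
def midReflect (e : Fin d → A) (k : Fin d) (σ : A →+ A) (x : A) : A := σ x + e k

/-- The reflection of positively oriented links: `(x, l) ↦ (θx, l)` for `l ≠ k`, while the `k`-link
`x → x + e_k` is carried onto the link `θx - e_k = σ x → θx`, i.e. onto `(σ x, k)` traversed
BACKWARDS. -/
def midLinkMap (e : Fin d → A) (k : Fin d) (σ : A →+ A) (l : Link A d) : Link A d :=
  (midReflect e k σ l.1 + (if l.2 = k then -e k else 0), l.2)

/-- The Osterwalder–Seiler reflection `Θ` of configurations in the mid-plane:
`(ΘU)(x, l) = U(θx, l)` for `l ≠ k` and `(ΘU)(x, k) = U(σ x, k)⁻¹` (the reversed `k`-links carry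
the inverse; the orientation rule of the tree's `configLinkReflect` / `GaugeConfig.timeReflect`). -/
noncomputable def configMidReflect {G : Type*} [Group G] (e : Fin d → A) (k : Fin d) (σ : A →+ A)
    (U : Config A d G) : Config A d G :=
  fun l => if l.2 = k then (U (midLinkMap e k σ l))⁻¹ else U (midLinkMap e k σ l)

/-- `θ x - e k = σ x`. -/
@[simp] theorem midReflect_sub (e : Fin d → A) (k : Fin d) (σ : A →+ A) (x : A) :
    midReflect e k σ x - e k = σ x := by
  simp [midReflect]

/-- `θ x + (-e k) = σ x`. -/
@[simp] theorem midReflect_add_neg (e : Fin d → A) (k : Fin d) (σ : A →+ A) (x : A) :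
    midReflect e k σ x + -e k = σ x := by
  simp [midReflect]

/-- `midLinkMap` on a `k`-link: `(x, k) ↦ (σ x, k)`. -/
@[simp] theorem midLinkMap_self (e : Fin d → A) (k : Fin d) (σ : A →+ A) (x : A) :
    midLinkMap e k σ (x, k) = (σ x, k) := by
  simp [midLinkMap]

/-- `midLinkMap` on an `l`-link, `l ≠ k`: `(x, l) ↦ (θ x, l)`. -/
theorem midLinkMap_other (e : Fin d → A) (k : Fin d) (σ : A →+ A) (x : A) {l : Fin d}
    (hl : l ≠ k) : midLinkMap e k σ (x, l) = (midReflect e k σ x, l) := by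
  simp [midLinkMap, hl]

/-- `configMidReflect` on a `k`-link. -/
@[simp] theorem configMidReflect_self {G : Type*} [Group G] (e : Fin d → A) (k : Fin d)
    (σ : A →+ A) (U : Config A d G) (x : A) : configMidReflect e k σ U (x, k) = (U (σ x, k))⁻¹ := by
  simp [configMidReflect]

/-- `configMidReflect` on an `l`-link, `l ≠ k`. -/
theorem configMidReflect_other {G : Type*} [Group G] (e : Fin d → A) (k : Fin d) (σ : A →+ A)
    (U : Config A d G) (x : A) {l : Fin d} (hl : l ≠ k) :
    configMidReflect e k σ U (x, l) = U (midReflect e k σ x, l) := by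
  simp [configMidReflect, hl, midLinkMap_other e k σ x hl]

/-! ## The closed half `{1 ≤ h ≤ Q}`, positive and crossing links -/

section Links

variable (e : Fin d → A) (k : Fin d) (Q : ℕ) (h : A →+ ZMod (2 * Q))

/-- The closed half `Λ₊ = {1 ≤ h ≤ Q}` of the mid-plane reflection (heights read in `[0, 2Q)`). -/
def InMidHalf (x : A) : Prop := 1 ≤ (h x).val ∧ (h x).val ≤ Q

/-- A POSITIVE link: both endpoints in `Λ₊ = {1 ≤ h ≤ Q}` (the links an observable of the closed
half may depend on). -/
def IsMidPosLink (l : Link A d) : Prop := InMidHalf Q h l.1 ∧ InMidHalf Q h (l.1 + e l.2)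

/-- A LOWER crossing link: a `k`-link from the layer `h = 0` to the layer `h = 1` (it crosses the
hyperplane `h = ½`). -/
def IsMidLowerLink (l : Link A d) : Prop := l.2 = k ∧ (h l.1).val = 0

/-- An UPPER crossing link: a `k`-link from the layer `h = Q` to the layer `h = Q + 1` (it crosses the
hyperplane `h = Q + ½`). -/
def IsMidUpperLink (l : Link A d) : Prop := l.2 = k ∧ (h l.1).val = Q

/-- A CROSSING link: lower or upper. -/
def IsMidCrossLink (l : Link A d) : Prop := l.2 = k ∧ ((h l.1).val = 0 ∨ (h l.1).val = Q)

/-- `F` is an observable of the closed half `{1 ≤ h ≤ Q}`: it depends only on the positive links. -/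
def IsMidObservable {G α : Type*} (F : Config A d G → α) : Prop :=
  ∀ U V : Config A d G, (∀ l, IsMidPosLink e Q h l → U l = V l) → F U = F V

variable {e k Q h}

/-- Lower crossing links are crossing. -/
theorem IsMidLowerLink.isMidCrossLink {l : Link A d} (hl : IsMidLowerLink k Q h l) :
    IsMidCrossLink k Q h l :=
  ⟨hl.1, Or.inl hl.2⟩

/-- Upper crossing links are crossing. -/
theorem IsMidUpperLink.isMidCrossLink {l : Link A d} (hl : IsMidUpperLink k Q h l) :
    IsMidCrossLink k Q h l :=
  ⟨hl.1, Or.inr hl.2⟩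

/-- A crossing link is lower or upper. -/
theorem isMidCrossLink_iff (l : Link A d) :
    IsMidCrossLink k Q h l ↔ IsMidLowerLink k Q h l ∨ IsMidUpperLink k Q h l := by
  unfold IsMidCrossLink IsMidLowerLink IsMidUpperLink
  tauto

/-- A half-space observable, restated as `DependsOn`: `F` depends only on the set of positive
links. -/
theorem dependsOn_of_isMidObservable {G α : Type*} {F : Config A d G → α}
    (hFo : IsMidObservable e Q h F) : DependsOn F {l | IsMidPosLink e Q h l} :=
  fun U V hUV => hFo U V fun l hl => hUV l hl

end Links

namespace IsSiteFrame

variable {e : Fin d → A} {k : Fin d} {σ : A →+ A} {Q : ℕ} {h : A →+ ZMod (2 * Q)}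
variable (hF : IsSiteFrame e k σ Q h)
include hF

/-! ## The mid-plane reflection of a site frame -/

/-- `θ (x + e k) = σ x` (`= θ x - e k`). -/
theorem midReflect_add_self (x : A) : midReflect e k σ (x + e k) = σ x := by
  rw [midReflect, hF.map_add_self, sub_add_cancel]

/-- `θ (x + e l) = θ x + e l` for `l ≠ k`. -/
theorem midReflect_add_other (x : A) {l : Fin d} (hl : l ≠ k) :
    midReflect e k σ (x + e l) = midReflect e k σ x + e l := by
  rw [midReflect, midReflect, hF.map_add_other x hl, add_right_comm]

/-- `θ (σ x) = x + e k`. -/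
theorem midReflect_map (x : A) : midReflect e k σ (σ x) = x + e k := by
  rw [midReflect, hF.invol]

/-- **The mid-plane reflection is an involution.** -/
@[simp] theorem midReflect_midReflect (x : A) : midReflect e k σ (midReflect e k σ x) = x := by
  unfold midReflect
  rw [map_add, hF.invol, hF.map_e_self, neg_add_cancel_right]

/-- The mid-plane reflection is involutive. -/
theorem midReflect_involutive : Function.Involutive (midReflect e k σ) := hF.midReflect_midReflect

/-- `σ (θ x) = x - e k`. -/
theorem map_midReflect (x : A) : σ (midReflect e k σ x) = x - e k := by
  unfold midReflect
  rw [map_add, hF.invol, hF.map_e_self, ← sub_eq_add_neg]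

/-- `midLinkMap` is an involution. -/
@[simp] theorem midLinkMap_midLinkMap (l : Link A d) :
    midLinkMap e k σ (midLinkMap e k σ l) = l := by
  obtain ⟨x, m⟩ := l
  by_cases hm : m = k
  · subst hm
    rw [midLinkMap_self, midLinkMap_self, hF.invol]
  · rw [midLinkMap_other e k σ x hm, midLinkMap_other e k σ _ hm, hF.midReflect_midReflect]

/-- `midLinkMap` is involutive. -/
theorem midLinkMap_involutive : Function.Involutive (midLinkMap (d := d) e k σ) :=
  hF.midLinkMap_midLinkMap

/-- `configMidReflect` is an involution. -/
theorem configMidReflect_configMidReflect {G : Type*} [Group G] (U : Config A d G) :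
    configMidReflect e k σ (configMidReflect e k σ U) = U := by
  funext l
  obtain ⟨x, m⟩ := l
  by_cases hm : m = k
  · subst hm
    rw [configMidReflect_self, configMidReflect_self, hF.invol, inv_inv]
  · rw [configMidReflect_other e k σ _ x hm, configMidReflect_other e k σ U _ hm,
      hF.midReflect_midReflect]

/-! ## Heights -/

/-- The height of the reflected site: `h (θ x) = -h x + 1` (`= 1 - h x`). -/
theorem height_midReflect (x : A) : h (midReflect e k σ x) = -h x + 1 := by
  rw [midReflect, map_add, hF.height_map, hF.height_self]

/-- `val` of the height of the reflected site: `0 ↦ 1`, `1 ↦ 0`, `c ↦ 2Q + 1 - c` for `c ≥ 2`. -/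
theorem val_height_midReflect (x : A) :
    (h (midReflect e k σ x)).val =
      if (h x).val ≤ 1 then 1 - (h x).val else 2 * Q + 1 - (h x).val := by
  have hQ := hF.two_le
  have hc := val_lt_two_mul hQ (h x)
  rw [hF.height_midReflect, val_add_one hQ, val_neg hQ]
  split_ifs <;> omega

/-- `val` of the height of `σ x` (recalled from the site frame): `0 ↦ 0`, `c ↦ 2Q - c`. -/
theorem val_height_map' (x : A) : (h (σ x)).val = if (h x).val = 0 then 0 else 2 * Q - (h x).val :=
  hF.val_height_map x

/-- On the layers `h = 0`, `h = Q`: `θ x = x + e k` (the site frame's layer axiom). -/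
theorem midReflect_of_isLayer {x : A} (hx : IsLayer Q h x) : midReflect e k σ x = x + e k := by
  rw [midReflect, hF.map_of_isLayer hx]

/-- On the layers: `θ (x + e k) = x`. -/
theorem midReflect_add_self_of_isLayer {x : A} (hx : IsLayer Q h x) :
    midReflect e k σ (x + e k) = x := by
  rw [hF.midReflect_add_self, hF.map_of_isLayer hx]

/-- A site of height `0` or `Q` (as a `val` statement) lies in a layer. -/
theorem isLayer_of_val {x : A} (hx : (h x).val = 0 ∨ (h x).val = Q) : IsLayer Q h x :=
  (hF.layer_iff_val x).2 hx

/-- On the layers (as a `val` statement): `σ x = x`. -/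
theorem map_of_val {x : A} (hx : (h x).val = 0 ∨ (h x).val = Q) : σ x = x :=
  hF.map_of_isLayer (hF.isLayer_of_val hx)

/-- On the layers (as a `val` statement): `σ (x + e l) = x + e l` for `l ≠ k` (the whole layer is
fixed). -/
theorem map_add_other_of_val {x : A} (hx : (h x).val = 0 ∨ (h x).val = Q) {l : Fin d} (hl : l ≠ k) :
    σ (x + e l) = x + e l := by
  refine hF.map_of_isLayer (hF.isLayer_of_val ?_)
  rw [hF.height_add_other x hl]
  exact hx

/-! ## Positive and crossing links under the reflection -/

/-- Positive `k`-links: base height `c` with `1 ≤ c` and `c + 1 ≤ Q`. -/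
theorem isMidPosLink_self_iff (x : A) :
    IsMidPosLink e Q h (x, k) ↔ 1 ≤ (h x).val ∧ (h x).val + 1 ≤ Q := by
  have hQ := hF.two_le
  have hc := val_lt_two_mul hQ (h x)
  unfold IsMidPosLink InMidHalf
  simp only
  rw [hF.val_height_add_self]
  split_ifs <;> omega

/-- Positive `l`-links, `l ≠ k`: base height `c` with `1 ≤ c ≤ Q`. -/
theorem isMidPosLink_other_iff (x : A) {l : Fin d} (hl : l ≠ k) :
    IsMidPosLink e Q h (x, l) ↔ 1 ≤ (h x).val ∧ (h x).val ≤ Q := by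
  unfold IsMidPosLink InMidHalf
  simp only
  rw [hF.height_add_other x hl]
  tauto

/-- Crossing links are not positive. -/
theorem not_isMidPosLink_of_isMidCrossLink {l : Link A d} (hl : IsMidCrossLink k Q h l) :
    ¬ IsMidPosLink e Q h l := by
  obtain ⟨x, m⟩ := l
  obtain ⟨hm, hc⟩ := hl
  simp only at hm hc
  subst hm
  rw [hF.isMidPosLink_self_iff]
  omega

/-- Lower crossing links are not upper crossing (`Q ≠ 0`). -/
theorem IsMidLowerLink.not_isMidUpperLink {l : Link A d} (hl : IsMidLowerLink k Q h l) :
    ¬ IsMidUpperLink k Q h l := by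
  have hQ := hF.two_le
  intro h'
  have h1 := hl.2
  rw [h'.2] at h1
  omega

/-- **The reflection carries positive and crossing links to non-positive links** (hypothesis
`hΘdep` of the abstract mechanism: the `P ∪ C`-coordinates of `ΘU` are read off links outside
`P`). -/
theorem not_isMidPosLink_midLinkMap {l : Link A d}
    (hl : IsMidPosLink e Q h l ∨ IsMidCrossLink k Q h l) :
    ¬ IsMidPosLink e Q h (midLinkMap e k σ l) := by
  obtain ⟨x, m⟩ := l
  have hQ := hF.two_le
  have hcx := val_lt_two_mul hQ (h x)
  by_cases hm : m = k
  · subst hm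
    rw [midLinkMap_self, hF.isMidPosLink_self_iff, hF.val_height_map']
    rw [hF.isMidPosLink_self_iff] at hl
    unfold IsMidCrossLink at hl
    simp only [true_and] at hl
    split_ifs <;> omega
  · rw [midLinkMap_other e k σ x hm, hF.isMidPosLink_other_iff _ hm, hF.val_height_midReflect]
    rw [hF.isMidPosLink_other_iff _ hm] at hl
    unfold IsMidCrossLink at hl
    simp only [hm, false_and, or_false] at hl
    split_ifs <;> omega

/-- **The reflection carries positive links to non-crossing links.** -/
theorem not_isMidCrossLink_midLinkMap {l : Link A d} (hl : IsMidPosLink e Q h l) :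
    ¬ IsMidCrossLink k Q h (midLinkMap e k σ l) := by
  obtain ⟨x, m⟩ := l
  have hQ := hF.two_le
  have hcx := val_lt_two_mul hQ (h x)
  by_cases hm : m = k
  · subst hm
    rw [midLinkMap_self]
    rw [hF.isMidPosLink_self_iff] at hl
    unfold IsMidCrossLink
    simp only [true_and]
    rw [hF.val_height_map']
    split_ifs <;> omega
  · rw [midLinkMap_other e k σ x hm]
    unfold IsMidCrossLink
    simp [hm]

/-- The reflection carries crossing links to crossing links (lower to lower, upper to upper:
`(x, k) ↦ (σ x, k) = (x, k)` on the layers). -/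
theorem midLinkMap_of_isMidCrossLink {l : Link A d} (hl : IsMidCrossLink k Q h l) :
    midLinkMap e k σ l = l := by
  obtain ⟨x, m⟩ := l
  obtain ⟨hm, hc⟩ := hl
  simp only at hm hc
  subst hm
  rw [midLinkMap_self, hF.map_of_val hc]

/-- On a crossing link `ΘU` carries the inverse of the same link variable:
`(ΘU)(x, k) = U(x, k)⁻¹` for `x` in a layer. -/
theorem configMidReflect_of_isMidCrossLink {G : Type*} [Group G] (U : Config A d G) {l : Link A d}
    (hl : IsMidCrossLink k Q h l) : configMidReflect e k σ U l = (U l)⁻¹ := by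
  obtain ⟨x, m⟩ := l
  obtain ⟨hm, hc⟩ := hl
  simp only at hm hc
  subst hm
  rw [configMidReflect_self, hF.map_of_val hc]

end IsSiteFrame

end TiltedRP

end Summit.QuantumFields.GaugeBoot
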